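import Summits.AtomisticToContinuum.HydrodynamicLimit.Theorems.BoxDissipativeWeakStrongEntropyAdmissibilityStubPathwiseSigned
import Summits.AtomisticToContinuum.HydrodynamicLimit.Theorems.BoxDissipativeWeakStrongEntropyAdmissibilityStubMeanEntropyForcing
import Summits.AtomisticToContinuum.HydrodynamicLimit.Theorems.BoxDissipativeWeakStrongEntropyAdmissibilityStubSignedGronwall
import Summits.AtomisticToContinuum.HydrodynamicLimit.Theorems.BoxDissipativeWeakStrongEntropyAdmissibilityStubBoxL1OfVanishes
import Summits.AtomisticToContinuum.HydrodynamicLimit.Theorems.BoxDissipativeWeakStrongEntropyAdmissibilitySplit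
import Summits.AtomisticToContinuum.HydrodynamicLimit.Theorems.BoxDissipativeWeakStrongRelativeEnergyStability
import Summits.AtomisticToContinuum.HydrodynamicLimit.Theorems.BoxDissipativeWeakStrongLocalGibbsFineScalePos
import HarnessLib

/-!
# Crux `EntropyAdmissibility` (stmt-AtomisticToContinuum-9903), line `mean_via_weak_strong` — C3 `stub_meanWeakStrongFineScale`
# DERIVED, and the headline reduction: given `FluxClosure`, the crux ⟺ S1b ⟺ the box-scale hydrodynamic limit in `L¹`

Route `BoxDissipativeWeakStrong`.  The strategist's line (`Cruxes/EntropyAdmissibility/Lines/mean_via_weak_strong.lean`) closes the crux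
from S1b (`stub_meanEntropyDeficit`, the clamp-renormalised local entropy inequality IN THE MEAN — the open heart), `FluxClosure` (the route's
other crux, item stmt-AtomisticToContinuum-9902) and C3 `stub_meanWeakStrongFineScale` (mean-form Březina–Feireisl weak–strong stability at box
scale).  The lead (c3) cut C3 along the seams of the landed `RES.*` engine into four sub-stubs, all LANDED:

* C3a `EAMeanWSa.stub_pathwiseSigned` (p172405) — the pathwise clamped relative-energy inequality with SIGNED entropy defect;
* C3b `EAMeanWSb.stub_meanEntropyForcing` (p172351) — S1b + statics ⇒ `K2f ∈ L¹(P_N)` and `E K2f ≤ ε` eventually (K2 tested with `φ := θ`);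
* C3c `EAMeanWSc.stub_signedGronwall` (p172725) — the clamped Grönwall in expectation with signed forcing `E|K1| + max 0 (E K2f)`;
* C3e `EAMeanWSe.stub_boxL1OfVanishes` (p172300) — clamped vanishing ⇒ box-scale `L¹(P_N ⊗ dx)` convergence.

This file composes them (`meanWeakStrongFineScale_of`: the bookkeeping of `RES.RelativeEnergyStability_of` at the GIVEN kinetic window, time
zero fed by the PROVED route item `LGFS.localGibbsFineScale_of_pos`, clamps by `RES.stub_clampChoice`, statics by
`RES.stub_clampedRelEnergyTimeZero`) into `stub_meanWeakStrongFineScale : Sig.stub_meanWeakStrongFineScale` (verbatim the skeleton's C3, child 3 of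
the strategist's split), and records the consequences over the landed glue `EASplit.*`, `EABirthCore.*`, `EABirthFS.*`:

  `FluxClosure → (EntropyAdmissibility ↔ InFrame Cdef)` and `FluxClosure → (EntropyAdmissibility ↔ InFrame Cptlgfs)`,

i.e. GIVEN the momentum-flux closure, the crux, its mean form S1b, and the box-scale hydrodynamic limit in `L¹(P_N ⊗ dx)` at every `t < T`
are EQUIVALENT; and the route's conclusion follows from `FluxClosure ∧ S1b` alone (`hydrodynamicLimit_of_deficit_of_fluxClosure`, by the route's
own `closes`).  The positive-time box-concentration stub S2a' of `Lines/birth.lean` has left the critical path.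

References: J. Březina, E. Feireisl, J. Math. Soc. Japan 70 (2018) §3.2; E. Feireisl, A. Novotný, *Singular Limits in Thermodynamics of
Viscous Fluids* (2009/2017) §3 (relative energy); H. Spohn, *Large Scale Dynamics of Interacting Particles* (1991) I §3.
-/

noncomputable section

open MeasureTheory Filter Set
open scoped ENNReal Topology InnerProductSpace BigOperators

namespace Summit.AtomisticToContinuum.HydrodynamicLimit.Theorems.EAMeanWS

open Literature.MathematicalPhysics.KineticTheory
open Summit.AtomisticToContinuum.HydrodynamicLimit.Theses
open Summit.AtomisticToContinuum.HydrodynamicLimit.Theorems.EABirthCore (InFrame Cdef Cdyn)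
open Summit.AtomisticToContinuum.HydrodynamicLimit.Theorems.EABirthFS3 (Cptlgfs)

section BDWSVocabulary

open Summit.AtomisticToContinuum.HydrodynamicLimit.Theorems.BDWS

/-- **C3 — mean-form weak–strong stability at box scale** (verbatim the skeleton's `Sig.stub_meanWeakStrongFineScale`, child 3 of the
strategist's split; the S1b antecedent is the landed verbatim copy `EAMeanWSb.Sig.stub_meanEntropyDeficit`): `FluxClosure → S1b →` in the
crux's frame, at every `t ∈ [0,T)` the box fields converge in `L¹(P_N ⊗ dx)` to `(ρ, ρu, E(ρ,u,θ))(t)`. -/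
def Sig.stub_meanWeakStrongFineScale : Prop :=
  BoxDissipativeWeakStrong.FluxClosure → EAMeanWSb.Sig.stub_meanEntropyDeficit →
  BoxDissipativeWeakStrong.HsEosLowDensity →
    ∃ ηc : ℝ, 0 < ηc ∧ ∀ η₁ : ℝ, 0 < η₁ → η₁ < ηc →
      ∀ (a₀ θ₀ : T3 → ℝ) (u₀ : T3 → V3), Continuous a₀ → Continuous θ₀ → Continuous u₀ →
        (∀ x, 0 < a₀ x) → (∀ x, 0 < θ₀ x) →
        ∃ σ₀ : ℝ, 0 < σ₀ ∧ ∀ σ : ℝ, 0 < σ → σ < σ₀ →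
          ∀ (T : ℝ) (ρ θ : ℝ → T3 → ℝ) (u : ℝ → T3 → V3), IsHardSphereEulerSolution σ T ρ u θ →
            (∀ t ∈ Ico 0 T, ∀ x, ρ t x * σ ^ 3 ≤ η₁ / 2) →
            ∀ Φ : FlowFamily σ,
              TendstoHydroFieldsAt (fun N => localGibbsLaw σ a₀ u₀ θ₀ N (Φ N)) Φ ρ u θ 0 →
              ∀ ℓ : ℕ → ℝ, (∀ N, 0 < ℓ N ∧ ℓ N ≤ 1) → Tendsto ℓ atTop (𝓝 0) →
                Tendsto (fun N : ℕ => ℓ N ^ 3 * ((N : ℝ) + 1)) atTop atTop →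
                ∀ t ∈ Ico 0 T,
                  Tendsto (fun N : ℕ => ∫⁻ z, ENNReal.ofReal (∫ x,
                      (|boxDensity σ ℓ Φ N t z x - ρ t x| + ‖boxMomentum σ ℓ Φ N t z x - ρ t x • u t x‖ +
                        |boxEnergy σ ℓ Φ N t z x - totalEnergyDensity (ρ t x) (u t x) (θ t x)|))
                    ∂(localGibbsLaw σ a₀ u₀ θ₀ N (Φ N))) atTop (𝓝 0)

end BDWSVocabulary

/-! ## The composition -/

/-- **C3 from its four sub-stubs (sorry-free bookkeeping; the analogue of `RES.RelativeEnergyStability_of` at the GIVEN kinetic window).**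
Common band threshold `min ηe (min ηa (min ηb ηd))` over the landed `RES.stub_clampChoice` (S0), `RES.stub_clampedRelEnergyTimeZero` (S1'),
C3c (fed with C3a, the landed S-G/S-J/S-B/S-M/S-E stubs, `FluxClosure` and the mean forcing C3b) and C3e; common density threshold
`min (1/2) (min σK σ₂)` with `σK` from the PROVED `LGFS.localGibbsFineScale_of_pos`; admissible clamps on `[0,t]`; chain C3e ∘ C3c ∘ S1' ∘ K0
at the given `ℓ` and `t`. -/
theorem meanWeakStrongFineScale_of (hPW : EAMeanWSa.Sig.stub_pathwiseSigned)
    (hMF : EAMeanWSb.Sig.stub_meanEntropyForcing) (hSG : EAMeanWSc.Sig.stub_signedGronwall)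
    (hL1 : EAMeanWSe.Sig.stub_boxL1OfVanishes) : Sig.stub_meanWeakStrongFineScale := by
  intro hFC hS1b hEos
  obtain ⟨ηe, hηe, H₀⟩ := RES.stub_clampChoice hEos
  obtain ⟨ηa, hηa, H₁⟩ := RES.stub_clampedRelEnergyTimeZero hEos
  obtain ⟨ηb, hηb, H₂⟩ := hSG hPW RES.stub_forcedGronwall RES.stub_flowJointMeasurable RES.stub_boxBalanceLaws
    RES.stub_cutEosMaster RES.stub_localGibbsEnergyMoment hFC (hMF hS1b hEos) hEos
  obtain ⟨ηd, hηd, H₃⟩ := hL1 hEos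
  refine ⟨min ηe (min ηa (min ηb ηd)), lt_min hηe (lt_min hηa (lt_min hηb hηd)), ?_⟩
  intro η₁ hη₁ hη₁lt a₀ θ₀ u₀ ha hθ hu hap hθp
  have hη₁e : η₁ < ηe := lt_of_lt_of_le hη₁lt (min_le_left _ _)
  have hη₁a : η₁ < ηa := lt_of_lt_of_le hη₁lt ((min_le_right _ _).trans (min_le_left _ _))
  have hη₁b : η₁ < ηb :=
    lt_of_lt_of_le hη₁lt ((min_le_right _ _).trans ((min_le_right _ _).trans (min_le_left _ _)))
  have hη₁d : η₁ < ηd :=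
    lt_of_lt_of_le hη₁lt ((min_le_right _ _).trans ((min_le_right _ _).trans (min_le_right _ _)))
  obtain ⟨σK, hσK, GK⟩ := LGFS.localGibbsFineScale_of_pos a₀ θ₀ u₀ ha hθ hu hap hθp
  obtain ⟨σ₂, hσ₂, G₂⟩ := H₂ η₁ hη₁ hη₁b a₀ θ₀ u₀ ha hθ hu hap hθp
  refine ⟨min (1 / 2) (min σK σ₂), lt_min one_half_pos (lt_min hσK hσ₂), ?_⟩
  intro σ hσ hσlt T ρ θ u hsol hguard Φ h0 ℓ hℓ hℓ0 hℓ3 t ht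
  have hσhalf : σ ≤ 1 / 2 := (lt_of_lt_of_le hσlt (min_le_left _ _)).le
  have hσK' : σ < σK := lt_of_lt_of_le hσlt ((min_le_right _ _).trans (min_le_left _ _))
  have hσ₂' : σ < σ₂ := lt_of_lt_of_le hσlt ((min_le_right _ _).trans (min_le_right _ _))
  have hT : 0 < T := lt_of_le_of_lt ht.1 ht.2
  have hℓw : RES.IsKineticWindow ℓ := ⟨hℓ, hℓ0, hℓ3⟩
  -- admissible deep clamps on `[0,t]` (S0), restricted to `[0,0]` for the statics
  obtain ⟨a, b, hab⟩ := H₀ η₁ hη₁ hη₁e σ hσ T ρ θ u hsol hguard t ht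
  have hab0 : RES.ClampAdmissible σ η₁ a b ρ θ 0 := RES.clampAdmissible_mono hab ht.1
  -- K0 at the given window (PROVED route item `LocalGibbsFineScale`)
  have hL10 : RES.BoxFieldsL1At σ a₀ u₀ θ₀ Φ ρ u θ ℓ 0 :=
    GK σ hσ hσK' T ρ θ u hsol hT Φ h0 ℓ hℓ hℓ0 hℓ3
  -- S1': statics by dominated convergence at t = 0
  have h0rel : RES.BoxClampedRelEnergyVanishesAt σ η₁ a b a₀ u₀ θ₀ Φ ρ u θ ℓ 0 :=
    H₁ η₁ hη₁ hη₁a a₀ θ₀ u₀ ha hθ hu hap hθp σ hσ hσhalf T ρ θ u hsol hT Φ ℓ hℓw a b hab0 hL10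
  -- C3c: the clamped Grönwall in expectation with signed forcing
  have htrel : RES.BoxClampedRelEnergyVanishesAt σ η₁ a b a₀ u₀ θ₀ Φ ρ u θ ℓ t :=
    G₂ σ hσ hσ₂' T ρ θ u hsol hguard Φ h0 ℓ hℓw t ht a b hab h0rel
  -- C3e: box-scale L¹ read-out
  exact H₃ η₁ hη₁ hη₁d a₀ θ₀ u₀ ha hθ hu hap hθp σ hσ hσhalf T ρ θ u hsol Φ ℓ hℓw t ht a b hab htrel

/-- **C3 holds**: `stub_meanWeakStrongFineScale`, the composition fed with the four landed sub-stubs C3a (p172405), C3b (p172351), C3c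
(p172725), C3e (p172300). -/
theorem stub_meanWeakStrongFineScale : Sig.stub_meanWeakStrongFineScale :=
  meanWeakStrongFineScale_of EAMeanWSa.stub_pathwiseSigned EAMeanWSb.stub_meanEntropyForcing EAMeanWSc.stub_signedGronwall
    EAMeanWSe.stub_boxL1OfVanishes

/-! ## Consequences: given `FluxClosure`, crux ⟺ S1b ⟺ box-scale hydrodynamic limit in `L¹` -/

/-- **S1b ∧ FluxClosure ⇒ the box-scale hydrodynamic limit in `L¹(P_N ⊗ dx)` at every `t < T`** (`InFrame Cptlgfs`), by the landed glue
`EASplit.inFrame_ptlgfs_of_subs` fed with C3. -/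
theorem inFrame_ptlgfs_of_deficit_of_fluxClosure (h₁ : InFrame Cdef) (h₂ : BoxDissipativeWeakStrong.FluxClosure) : InFrame Cptlgfs :=
  EASplit.inFrame_ptlgfs_of_subs h₁ h₂ stub_meanWeakStrongFineScale

/-- **S1b ∧ FluxClosure ⇒ the crux `EntropyAdmissibility` AS TYPED** (the line closed modulo its two crux-level stubs), by the landed glue
`EASplit.entropyAdmissibility_of_subs` fed with C3. -/
theorem entropyAdmissibility_of_deficit_of_fluxClosure (h₁ : InFrame Cdef) (h₂ : BoxDissipativeWeakStrong.FluxClosure) :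
    BoxDissipativeWeakStrong.EntropyAdmissibility :=
  EASplit.entropyAdmissibility_of_subs h₁ h₂ stub_meanWeakStrongFineScale

/-- **Given `FluxClosure`, the crux is EQUIVALENT to its mean form S1b** (`⇒`: landed necessity `EABirthCore.inFrame_def_of_inFrame_dyn ∘
inFrame_dyn_of_crux`, unconditional; `⇐`: this file). -/
theorem entropyAdmissibility_iff_deficit (h₂ : BoxDissipativeWeakStrong.FluxClosure) :
    BoxDissipativeWeakStrong.EntropyAdmissibility ↔ InFrame Cdef :=
  ⟨fun h => EABirthCore.inFrame_def_of_inFrame_dyn (EABirthCore.inFrame_dyn_of_crux h),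
    fun h₁ => entropyAdmissibility_of_deficit_of_fluxClosure h₁ h₂⟩

/-- **Given `FluxClosure`, the crux is EQUIVALENT to the box-scale hydrodynamic limit in `L¹(P_N ⊗ dx)` at every `t < T`**
(`⇐`: landed `EABirthFS.crux_of_fineScaleLLN`, unconditional; `⇒`: this file). -/
theorem entropyAdmissibility_iff_ptlgfs (h₂ : BoxDissipativeWeakStrong.FluxClosure) :
    BoxDissipativeWeakStrong.EntropyAdmissibility ↔ InFrame Cptlgfs :=
  ⟨fun h => inFrame_ptlgfs_of_deficit_of_fluxClosure (EABirthCore.inFrame_def_of_inFrame_dyn (EABirthCore.inFrame_dyn_of_crux h)) h₂,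
    EABirthFS.crux_of_fineScaleLLN⟩

/-- **The route's conclusion from `FluxClosure ∧ S1b` alone**: the sub-problem statement `HydrodynamicLimit` follows from the momentum-flux
closure and the MEAN clamp-renormalised local entropy inequality, by the route's own deciding theorem `BoxDissipativeWeakStrong.closes` fed with
this file's `entropyAdmissibility_of_deficit_of_fluxClosure`, the proved `RelativeEnergyStability_proof`, `LGFS.localGibbsFineScale_of_pos` and
`HsEosLowDensity_holds` (a CONDITIONAL result: both antecedents are open cruxes). -/
theorem hydrodynamicLimit_of_deficit_of_fluxClosure (h₁ : InFrame Cdef) (h₂ : BoxDissipativeWeakStrong.FluxClosure) :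
    _root_.HydrodynamicLimit :=
  BoxDissipativeWeakStrong.closes h₂ (entropyAdmissibility_of_deficit_of_fluxClosure h₁ h₂) RelativeEnergyStability_proof
    LGFS.localGibbsFineScale_of_pos BoxDissipativeWeakStrong.HsEosLowDensity_holds

end Summit.AtomisticToContinuum.HydrodynamicLimit.Theorems.EAMeanWS

end
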